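/-
Copyright (c) 2026 the pub-hodgecm-mathlib formalisation cell (harness21).  Prover seat hodgecm-mathlib-K2E3-p14 (g4) (free E3 hand on the E1 campaign
«EIS-RANK-ONE», deal [D2] (d₃ cusp) of K2E1-plan (g3) 2026-09-04T05:38:45Z), h413 = `stmt-HodgeConjecture-24833`, rung R6d₃ assembled: the UNIFORM BOUND IN THE CUSP
`∀ g, T < H(g) → ‖E(f)(g) − E(f)_B(g)‖ ≤ μ_F(D_F)⁻¹·B + μ_E(D_E)⁻¹·C_E` on `U(J₃)`, hypothesis-first.  2026-09-04.
-/
import Summits.HodgeConjecture.HodgeConjecture.Theorems.K2E1BigCellHeisenbergDilationU3   -- ★ (b-i)₃ (this seat): `bigCell_heisenberg_dilation_three` & the scalars; (a)₃ p857586, (b)₃ p857726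
import Literature.NumberTheory.Automorphic.UnitaryGroupTorusSiegelIntegral                -- ★ `borelHeight_pos`
import HarnessLib

/-!
# h413 ∕ Track B «K2-LIT», «EIS-RANK-ONE» R6d₃ (cusp) — helper `K2E1EisensteinMinusConstantTermCuspBoundU3`:
# the uniform bound for `E(f) − E(f)_B` in the cusp of `U(J₃)`

Cell `pub/hodgecm-mathlib`, crux H413 = `stmt-HodgeConjecture-24833`, route `HCCMUnconditional`; DEAL [D2] (d₃ cusp) of the dealer K2E1-plan (g3) (the `N = 3` twin of
★ p857628 `K2E1EisensteinMinusConstantTermCuspBoundU2`).  THEOREMS ONLY (no `def`, no `instance`, no `notation`, no named-fact hypothesis, no `sorry`); lane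
`--kind proof --supports stmt-HodgeConjecture-24833 --as helper` (count-neutral).

ASSEMBLY.  For `g = heis(X_u, θ t_u)·t·k` with `H(k) ≤ T < H(g)` (so `‖d₀‖_E = H(g)∕H(k) > 1`, `L := ‖d₀‖⁻¹ < 1`): (b-i)₃ `bigCell_heisenberg_dilation_three` gives the
`hdil` of (b)₃ with `m = χ(d₂)‖d₂‖^z`, `λ₁ = d₀⁻¹d₁`, `λ₂ = Λ₂` (`exists_centralScalar_three`), `‖m‖ = L^{Re z}`, `|λ₁|_E = |λ₂|_F = L`
(`norm_multiplier_eq_rpow_three`); the two decay binders AT `k` — `hdecF` (centre-line layer summed over `x₀ ∈ E`, `≤ B·(L⁻¹)^θ·(L⁻¹)^{−β_F}`, quantified over the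
dilation data `(λ₁, λ₂, Y)` with `|λ₂| ≤ 1`, `|λ₁|_E = |λ₂|_F`) and `hdecE` (★ (E2) shape over `E`, `|λ₁| ≤ 1`) — feed ★ (b)₃ `norm_sub_borelConstantTerm_le_const_three`:
**`norm_sub_borelConstantTerm_le_of_iwasawa_three`**; quantifying over the Iwasawa decomposition `G(𝔸) = N(𝔸)T(𝔸)K` with `H ≤ T` on `K` gives the R6e shape
**`forall_norm_sub_borelConstantTerm_le_three`**: `∀ g, T < H(g) → ‖E(f)(g) − E(f)_B(g)‖ ≤ μ_F(D_F)⁻¹·B + μ_E(D_E)⁻¹·C_E`.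

HONEST LABEL.  Count-neutral helper; proves no printed statement; HC_CM is proved only modulo the 7 printed citations (2 remaining named inputs: hLiu418 =
`stmt-HodgeConjecture-24832`, h413 = `stmt-HodgeConjecture-24833`) until rung 0 closes.

## References
* [Garrett2018] P. Garrett, *Modern Analysis of Automorphic Forms by Example*, vol. 1 (2018), §2.9.
* [MoeglinWaldspurger1995] C. Mœglin, J.-L. Waldspurger, *Spectral Decomposition and Eisenstein Series* (1995), I.2.12, II.1.7.
-/

set_option autoImplicit false
set_option linter.dupNamespace false  -- the mandated namespace repeats the summit's segment (`HodgeConjecture.HodgeConjecture`)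

noncomputable section

open scoped Matrix NNReal
open MeasureTheory NumberField IsDedekindDomain MulAction
open Literature.NumberTheory.Automorphic Literature.NumberTheory.Automorphic.UnitaryGroup Literature.NumberTheory.GaloisRepresentations
open Summit.HodgeConjecture.HodgeConjecture.Cruxes.H413.K2E1BorelEisensteinU
open Summit.HodgeConjecture.HodgeConjecture.Cruxes.H413.K2E1BigCellLineDilationU2
open Summit.HodgeConjecture.HodgeConjecture.Cruxes.H413.K2E1EisensteinMinusConstantTermBoundU3
open Summit.HodgeConjecture.HodgeConjecture.Cruxes.H413.K2E1BigCellHeisenbergDilationU3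

namespace Summit.HodgeConjecture.HodgeConjecture.Cruxes.H413.K2E1EisensteinMinusConstantTermCuspBoundU3

variable {F E : Type} [Field F] [NumberField F] [Field E] [NumberField E] [Algebra F E] [Algebra.IsQuadraticExtension F E] {c : E ≃ₐ[F] E}
  {δ : E}

/-- **THE BOUND AT ONE `g = heis(X_u, θ t_u)·t·k` WITH `H(k) ≤ T < H(g)`**: all of ★ (a)₃ ∕ (b)₃ ∕ (b-i)₃ assembled — Poisson's hypotheses and `hnorm` at this `g`
(two layers, in the letters of ★ p857586: `Φ_g(X,s) = f(ι(w₀)·heisChart(X, θ s)·g)`, `Φ^Z_g(X) = μ_F(D_F)⁻¹ ∫ Φ_g(X,s) ds` — the (D2-c) FILE A∕B heads of K2E4-p11 (g3) discharge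
`hΦc`∕`hΦi`∕`hloc`∕`hΦZc`∕`hΦZi`∕`hlocZ` by name), the two Fourier-side decay binders at `k` (the centre-line layer summed over `x₀ ∈ E` with `W = B·(L⁻¹)^θ`, quantified
over the dilation data `(λ₁, λ₂, Y)`; the `E`-layer in ★ (E2)'s shape), the section law of exponent `z` with `χ` unitary, `θ + 1 ≤ Re z + β_F`, `2 ≤ Re z + β_E`:
`‖E(f)(g) − E(f)_B(g)‖ ≤ μ_F(D_F)⁻¹·B + μ_E(D_E)⁻¹·C_E`. [cite: Garrett2018, §2.9] [cite: MoeglinWaldspurger1995, II.1.7] -/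
theorem norm_sub_borelConstantTerm_le_of_iwasawa_three (hc : c * c = 1) (hcδ : c δ = -δ) (hδ : δ ≠ 0)
    [MeasurableSpace (quasiSplit F E c 3).Adelic] [BorelSpace (quasiSplit F E c 3).Adelic]
    (νN : Measure ↥(adelicUnipotent F E c 3)) [νN.IsMulLeftInvariant] [νN.IsInvInvariant]
    (χ : HeckeCharacter E) (hχ : χ.IsUnitary) (z : ℂ) {f : (quasiSplit F E c 3).Adelic → ℂ} (hfm : Measurable f)
    (hfN : ∀ (n : ↥(adelicUnipotent F E c 3)) (y : (quasiSplit F E c 3).Adelic), f ((n : (quasiSplit F E c 3).Adelic) * y) = f y)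
    (hfB : ∀ b ∈ borelU (c : E →+* E) ((StdForm.antidiagonal 3).over E), ∀ x : (quasiSplit F E c 3).Adelic, f ((quasiSplit F E c 3).toAdelic b * x) = f x)
    (hf : ∀ (b g : (quasiSplit F E c 3).Adelic) (hb : b ∈ borelAdelic F E c 3),
      f (b * g) = ((χ (diagUnit hb 0) : ℂˣ) : ℂ) * ((ideleNorm (diagUnit hb 0) : ℝ) : ℂ) ^ z * f g)
    {𝓕 : Set ↥(adelicUnipotent F E c 3)} (h𝓕 : IsFundamentalDomain ↥(rationalUnipotent F E c 3) 𝓕 νN) (h𝓕₀ : νN 𝓕 ≠ 0) (h𝓕top : νN 𝓕 ≠ ⊤)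
    [MeasurableSpace (AdeleRing (𝓞 F) F)] [BorelSpace (AdeleRing (𝓞 F) F)] (μF : Measure (AdeleRing (𝓞 F) F)) [μF.IsAddHaarMeasure]
    [MeasurableSpace (AdeleRing (𝓞 E) E)] [BorelSpace (AdeleRing (𝓞 E) E)] (μE : Measure (AdeleRing (𝓞 E) E)) [μE.IsAddHaarMeasure]
    {B CE βF βE θ T : ℝ} (hB : 0 ≤ B) (hCE : 0 ≤ CE) (hθ : θ + 1 ≤ z.re + βF) (hσE : 2 ≤ z.re + βE)
    -- the data of `g = heis(X_u, θ t_u)·t·k`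
    (Xu : AdeleRing (𝓞 E) E) (tu : AdeleRing (𝓞 F) F) (t : ↥(torusInBorel F E c 3)) (k : (quasiSplit F E c 3).Adelic) (hk : (borelHeight k : ℝ) ≤ T)
    (hT : T < (borelHeight (((heisChart hc (Xu, traceZeroLine F E c hcδ hδ tu) : ↥(adelicUnipotent F E c 3)) : (quasiSplit F E c 3).Adelic) * ((t : borelAdelic F E c 3) : (quasiSplit F E c 3).Adelic) * k) : ℝ))
    -- Godement ∕ summability ∕ Poisson (two layers) ∕ normalisation at this `g`
    (hfin : ∫⁻ u in 𝓕, (∑' q : (quasiSplit F E c 3).quotientSubgroup ⧸ (borelAdelic F E c 3).subgroupOf (quasiSplit F E c 3).quotientSubgroup,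
        ‖f ((((q.out : (quasiSplit F E c 3).quotientSubgroup) : (quasiSplit F E c 3).Adelic))⁻¹ * (u : (quasiSplit F E c 3).Adelic) * (((heisChart hc (Xu, traceZeroLine F E c hcδ hδ tu) : ↥(adelicUnipotent F E c 3)) : (quasiSplit F E c 3).Adelic) * ((t : borelAdelic F E c 3) : (quasiSplit F E c 3).Adelic) * k))‖ₑ) ∂νN < ⊤)
    (hs : Summable fun q : Quotient (orbitRel ↥(borelU (c : E →+* E) ((StdForm.antidiagonal 3).over E)) ↥(unitaryGroupOfForm (c : E →+* E) ((StdForm.antidiagonal 3).over E))) =>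
      f ((quasiSplit F E c 3).toAdelic (Quotient.out q : ↥(unitaryGroupOfForm (c : E →+* E) ((StdForm.antidiagonal 3).over E))) * (((heisChart hc (Xu, traceZeroLine F E c hcδ hδ tu) : ↥(adelicUnipotent F E c 3)) : (quasiSplit F E c 3).Adelic) * ((t : borelAdelic F E c 3) : (quasiSplit F E c 3).Adelic) * k)))
    (hsumN : Summable fun p : E × F => ‖f (((quasiSplit F E c 3).toAdelic (weylLongU (c : E →+* E) (rfl : ((StdForm.antidiagonal 3).over E) = ((StdForm.antidiagonal 3).over E)))) * ((heisChart hc (algebraMap E (AdeleRing (𝓞 E) E) p.1, traceZeroLine F E c hcδ hδ (algebraMap F (AdeleRing (𝓞 F) F) p.2)) : ↥(adelicUnipotent F E c 3)) : (quasiSplit F E c 3).Adelic) * (((heisChart hc (Xu, traceZeroLine F E c hcδ hδ tu) : ↥(adelicUnipotent F E c 3)) : (quasiSplit F E c 3).Adelic) * ((t : borelAdelic F E c 3) : (quasiSplit F E c 3).Adelic) * k))‖)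
    (hΦc : ∀ x₀ : E, Continuous fun s : AdeleRing (𝓞 F) F => f (((quasiSplit F E c 3).toAdelic (weylLongU (c : E →+* E) (rfl : ((StdForm.antidiagonal 3).over E) = ((StdForm.antidiagonal 3).over E)))) * ((heisChart hc (algebraMap E (AdeleRing (𝓞 E) E) x₀, traceZeroLine F E c hcδ hδ s) : ↥(adelicUnipotent F E c 3)) : (quasiSplit F E c 3).Adelic) * (((heisChart hc (Xu, traceZeroLine F E c hcδ hδ tu) : ↥(adelicUnipotent F E c 3)) : (quasiSplit F E c 3).Adelic) * ((t : borelAdelic F E c 3) : (quasiSplit F E c 3).Adelic) * k)))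
    (hΦi : ∀ x₀ : E, Integrable (fun s : AdeleRing (𝓞 F) F => f (((quasiSplit F E c 3).toAdelic (weylLongU (c : E →+* E) (rfl : ((StdForm.antidiagonal 3).over E) = ((StdForm.antidiagonal 3).over E)))) * ((heisChart hc (algebraMap E (AdeleRing (𝓞 E) E) x₀, traceZeroLine F E c hcδ hδ s) : ↥(adelicUnipotent F E c 3)) : (quasiSplit F E c 3).Adelic) * (((heisChart hc (Xu, traceZeroLine F E c hcδ hδ tu) : ↥(adelicUnipotent F E c 3)) : (quasiSplit F E c 3).Adelic) * ((t : borelAdelic F E c 3) : (quasiSplit F E c 3).Adelic) * k))) μF)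
    (hloc : ∀ x₀ : E, ∀ C₀ : Set (AdeleRing (𝓞 F) F), IsCompact C₀ → ∃ u : F → ℝ, Summable u ∧
      ∀ x ∈ C₀, ∀ ξ : F, ‖f (((quasiSplit F E c 3).toAdelic (weylLongU (c : E →+* E) (rfl : ((StdForm.antidiagonal 3).over E) = ((StdForm.antidiagonal 3).over E)))) * ((heisChart hc (algebraMap E (AdeleRing (𝓞 E) E) x₀, traceZeroLine F E c hcδ hδ (x + algebraMap F (AdeleRing (𝓞 F) F) ξ)) : ↥(adelicUnipotent F E c 3)) : (quasiSplit F E c 3).Adelic) * (((heisChart hc (Xu, traceZeroLine F E c hcδ hδ tu) : ↥(adelicUnipotent F E c 3)) : (quasiSplit F E c 3).Adelic) * ((t : borelAdelic F E c 3) : (quasiSplit F E c 3).Adelic) * k))‖ ≤ u ξ)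
    (hΦZc : Continuous (fun X : AdeleRing (𝓞 E) E => ((μF (adeleFundamentalDomain F)).toReal⁻¹ : ℂ) * ∫ s, f (((quasiSplit F E c 3).toAdelic (weylLongU (c : E →+* E) (rfl : ((StdForm.antidiagonal 3).over E) = ((StdForm.antidiagonal 3).over E)))) * ((heisChart hc (X, traceZeroLine F E c hcδ hδ s) : ↥(adelicUnipotent F E c 3)) : (quasiSplit F E c 3).Adelic) * (((heisChart hc (Xu, traceZeroLine F E c hcδ hδ tu) : ↥(adelicUnipotent F E c 3)) : (quasiSplit F E c 3).Adelic) * ((t : borelAdelic F E c 3) : (quasiSplit F E c 3).Adelic) * k)) ∂μF))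
    (hΦZi : Integrable (fun X : AdeleRing (𝓞 E) E => ((μF (adeleFundamentalDomain F)).toReal⁻¹ : ℂ) * ∫ s, f (((quasiSplit F E c 3).toAdelic (weylLongU (c : E →+* E) (rfl : ((StdForm.antidiagonal 3).over E) = ((StdForm.antidiagonal 3).over E)))) * ((heisChart hc (X, traceZeroLine F E c hcδ hδ s) : ↥(adelicUnipotent F E c 3)) : (quasiSplit F E c 3).Adelic) * (((heisChart hc (Xu, traceZeroLine F E c hcδ hδ tu) : ↥(adelicUnipotent F E c 3)) : (quasiSplit F E c 3).Adelic) * ((t : borelAdelic F E c 3) : (quasiSplit F E c 3).Adelic) * k)) ∂μF) μE)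
    (hlocZ : ∀ C₀ : Set (AdeleRing (𝓞 E) E), IsCompact C₀ → ∃ u : E → ℝ, Summable u ∧
      ∀ x ∈ C₀, ∀ ξ : E, ‖((μF (adeleFundamentalDomain F)).toReal⁻¹ : ℂ) * ∫ s, f (((quasiSplit F E c 3).toAdelic (weylLongU (c : E →+* E) (rfl : ((StdForm.antidiagonal 3).over E) = ((StdForm.antidiagonal 3).over E)))) * ((heisChart hc ((x + algebraMap E (AdeleRing (𝓞 E) E) ξ), traceZeroLine F E c hcδ hδ s) : ↥(adelicUnipotent F E c 3)) : (quasiSplit F E c 3).Adelic) * (((heisChart hc (Xu, traceZeroLine F E c hcδ hδ tu) : ↥(adelicUnipotent F E c 3)) : (quasiSplit F E c 3).Adelic) * ((t : borelAdelic F E c 3) : (quasiSplit F E c 3).Adelic) * k)) ∂μF‖ ≤ u ξ)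
    (hnorm : ((νN 𝓕).toReal⁻¹ : ℝ) • ∫ v : ↥(adelicUnipotent F E c 3), f (((quasiSplit F E c 3).toAdelic (weylLongU (c : E →+* E) (rfl : ((StdForm.antidiagonal 3).over E) = ((StdForm.antidiagonal 3).over E)))) * (v : (quasiSplit F E c 3).Adelic) * (((heisChart hc (Xu, traceZeroLine F E c hcδ hδ tu) : ↥(adelicUnipotent F E c 3)) : (quasiSplit F E c 3).Adelic) * ((t : borelAdelic F E c 3) : (quasiSplit F E c 3).Adelic) * k)) ∂νN =
      ((μE (adeleFundamentalDomain E)).toReal⁻¹ : ℂ) * ∫ X, ((μF (adeleFundamentalDomain F)).toReal⁻¹ : ℂ) * ∫ s, f (((quasiSplit F E c 3).toAdelic (weylLongU (c : E →+* E) (rfl : ((StdForm.antidiagonal 3).over E) = ((StdForm.antidiagonal 3).over E)))) * ((heisChart hc (X, traceZeroLine F E c hcδ hδ s) : ↥(adelicUnipotent F E c 3)) : (quasiSplit F E c 3).Adelic) * (((heisChart hc (Xu, traceZeroLine F E c hcδ hδ tu) : ↥(adelicUnipotent F E c 3)) : (quasiSplit F E c 3).Adelic) * ((t : borelAdelic F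 E c 3) : (quasiSplit F E c 3).Adelic) * k)) ∂μF ∂μE)
    -- the two Fourier-side decay binders at `k`
    (hdecF : ∀ (l₁ : (AdeleRing (𝓞 E) E)ˣ) (l₂ : (AdeleRing (𝓞 F) F)ˣ) (Y : AdeleRing (𝓞 E) E), ((IdeleClassGroup.ideleNorm F l₂ : ℝ≥0) : ℝ) ≤ 1 →
      ((IdeleClassGroup.ideleNorm E l₁ : ℝ≥0) : ℝ) = ((IdeleClassGroup.ideleNorm F l₂ : ℝ≥0) : ℝ) →
      (∀ x₀ : E, Summable fun η : F =>
        ‖∫ v, f (((quasiSplit F E c 3).toAdelic (weylLongU (c : E →+* E) (rfl : ((StdForm.antidiagonal 3).over E) = ((StdForm.antidiagonal 3).over E)))) * ((heisChart hc ((l₁ : AdeleRing (𝓞 E) E) * (algebraMap E (AdeleRing (𝓞 E) E) x₀ - Y), traceZeroLine F E c hcδ hδ v) : ↥(adelicUnipotent F E c 3)) : (quasiSplit F E c 3).Adelic) * k) * (adeleAddChar F (algebraMap F (AdeleRing (𝓞 F) F) η * ((l₂⁻¹ : (AdeleRing (𝓞 F) F)ˣ) : AdeleRing (𝓞 F) F)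 * v) : ℂ) ∂μF‖) ∧
      (Summable fun x₀ : E => ∑' η : F, ({0}ᶜ : Set F).indicator (fun η =>
        ‖∫ v, f (((quasiSplit F E c 3).toAdelic (weylLongU (c : E →+* E) (rfl : ((StdForm.antidiagonal 3).over E) = ((StdForm.antidiagonal 3).over E)))) * ((heisChart hc ((l₁ : AdeleRing (𝓞 E) E) * (algebraMap E (AdeleRing (𝓞 E) E) x₀ - Y), traceZeroLine F E c hcδ hδ v) : ↥(adelicUnipotent F E c 3)) : (quasiSplit F E c 3).Adelic) * k) * (adeleAddChar F (algebraMap F (AdeleRing (𝓞 F) F) η * ((l₂⁻¹ : (AdeleRing (𝓞 F) F)ˣ) : AdeleRing (𝓞 F) F) * v) : ℂ) ∂μF‖) η) ∧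
      ∑' x₀ : E, ∑' η : F, ({0}ᶜ : Set F).indicator (fun η =>
          ‖∫ v, f (((quasiSplit F E c 3).toAdelic (weylLongU (c : E →+* E) (rfl : ((StdForm.antidiagonal 3).over E) = ((StdForm.antidiagonal 3).over E)))) * ((heisChart hc ((l₁ : AdeleRing (𝓞 E) E) * (algebraMap E (AdeleRing (𝓞 E) E) x₀ - Y), traceZeroLine F E c hcδ hδ v) : ↥(adelicUnipotent F E c 3)) : (quasiSplit F E c 3).Adelic) * k) * (adeleAddChar F (algebraMap F (AdeleRing (𝓞 F) F) η * ((l₂⁻¹ : (AdeleRing (𝓞 F) F)ˣ) : AdeleRing (𝓞 F) F) * v) : ℂ) ∂μF‖) η ≤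
        B * (((IdeleClassGroup.ideleNorm F l₂ : ℝ≥0) : ℝ)⁻¹) ^ θ * (((IdeleClassGroup.ideleNorm F l₂ : ℝ≥0) : ℝ)⁻¹) ^ (-βF))
    (hdecE : ∀ l₁ : (AdeleRing (𝓞 E) E)ˣ, ((IdeleClassGroup.ideleNorm E l₁ : ℝ≥0) : ℝ) ≤ 1 →
      (Summable fun ξ : E =>
        ‖∫ V, (((μF (adeleFundamentalDomain F)).toReal⁻¹ : ℂ) * ∫ s, f (((quasiSplit F E c 3).toAdelic (weylLongU (c : E →+* E) (rfl : ((StdForm.antidiagonal 3).over E) = ((StdForm.antidiagonal 3).over E)))) * ((heisChart hc (V, traceZeroLine F E c hcδ hδ s) : ↥(adelicUnipotent F E c 3)) : (quasiSplit F E c 3).Adelic) * k) ∂μF) * (adeleAddChar E (algebraMap E (AdeleRing (𝓞 E) E) ξ * ((l₁⁻¹ : (AdeleRing (𝓞 E) E)ˣ) : AdeleRing (𝓞 E) E) * V) : ℂ) ∂μE‖) ∧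
      ∑' ξ : E, ({0}ᶜ : Set E).indicator (fun ξ =>
          ‖∫ V, (((μF (adeleFundamentalDomain F)).toReal⁻¹ : ℂ) * ∫ s, f (((quasiSplit F E c 3).toAdelic (weylLongU (c : E →+* E) (rfl : ((StdForm.antidiagonal 3).over E) = ((StdForm.antidiagonal 3).over E)))) * ((heisChart hc (V, traceZeroLine F E c hcδ hδ s) : ↥(adelicUnipotent F E c 3)) : (quasiSplit F E c 3).Adelic) * k) ∂μF) * (adeleAddChar E (algebraMap E (AdeleRing (𝓞 E) E) ξ * ((l₁⁻¹ : (AdeleRing (𝓞 E) E)ˣ) : AdeleRing (𝓞 E) E) * V) : ℂ) ∂μE‖) ξ ≤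
        CE * (((IdeleClassGroup.ideleNorm E l₁ : ℝ≥0) : ℝ)⁻¹) ^ (-βE))
    :
    ‖eisensteinSeriesU f (((heisChart hc (Xu, traceZeroLine F E c hcδ hδ tu) : ↥(adelicUnipotent F E c 3)) : (quasiSplit F E c 3).Adelic) * ((t : borelAdelic F E c 3) : (quasiSplit F E c 3).Adelic) * k) - borelConstantTerm νN 𝓕 (eisensteinSeriesU f) (((heisChart hc (Xu, traceZeroLine F E c hcδ hδ tu) : ↥(adelicUnipotent F E c 3)) : (quasiSplit F E c 3).Adelic) * ((t : borelAdelic F E c 3) : (quasiSplit F E c 3).Adelic) * k)‖ ≤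
      (μF (adeleFundamentalDomain F)).toReal⁻¹ * B + (μE (adeleFundamentalDomain E)).toReal⁻¹ * CE := by
  -- the central scalar `Λ₂`, the multiplier, `L = |Λ₂| = ‖d₀‖⁻¹ ≤ 1` from the heights
  obtain ⟨Λ₂, hΛ₂⟩ := exists_centralScalar_three hcδ hδ t
  obtain ⟨hm, hL⟩ := norm_multiplier_eq_rpow_three χ hχ z t Λ₂ hΛ₂
  have hHk : 0 < (borelHeight k : ℝ) := by exact_mod_cast borelHeight_pos k
  have hd0 : 1 < ((IdeleClassGroup.ideleNorm E (diagUnit (t : borelAdelic F E c 3).2 0) : ℝ≥0) : ℝ) := by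
    rw [mul_assoc, borelHeight_unipotent_mul (heisChart hc (Xu, traceZeroLine F E c hcδ hδ tu)).2, borelHeight_torus_mul' (glDiagonal_diagUnit_torus t), NNReal.coe_mul] at hT
    by_contra hle
    have : ((IdeleClassGroup.ideleNorm E (diagUnit (t : borelAdelic F E c 3).2 0) : ℝ≥0) : ℝ) * (borelHeight k : ℝ) ≤ 1 * T := mul_le_mul (not_lt.1 hle) hk hHk.le zero_le_one
    linarith
  have hΛnorm : ((IdeleClassGroup.ideleNorm F Λ₂ : ℝ≥0) : ℝ) = ((IdeleClassGroup.ideleNorm E (diagUnit (t : borelAdelic F E c 3).2 0) : ℝ≥0) : ℝ)⁻¹ := by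
    rw [ideleNorm_centralScalar_three t Λ₂ hΛ₂, NNReal.coe_inv]
  have hΛle : ((IdeleClassGroup.ideleNorm F Λ₂ : ℝ≥0) : ℝ) ≤ 1 := by rw [hΛnorm]; exact inv_le_one_of_one_le₀ hd0.le
  have hl₁ : ((IdeleClassGroup.ideleNorm E (((diagUnit (t : borelAdelic F E c 3).2 0)⁻¹ * diagUnit (t : borelAdelic F E c 3).2 1 : (AdeleRing (𝓞 E) E)ˣ)) : ℝ≥0) : ℝ) ≤ 1 := by rw [hL]; exact hΛle
  obtain ⟨hsF, hsA, hdF⟩ := hdecF (((diagUnit (t : borelAdelic F E c 3).2 0)⁻¹ * diagUnit (t : borelAdelic F E c 3).2 1 : (AdeleRing (𝓞 E) E)ˣ)) Λ₂ (-Xu) hΛle hL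
  obtain ⟨hsE, hdE⟩ := hdecE (((diagUnit (t : borelAdelic F E c 3).2 0)⁻¹ * diagUnit (t : borelAdelic F E c 3).2 1 : (AdeleRing (𝓞 E) E)ˣ)) hl₁
  exact norm_sub_borelConstantTerm_le_const_three hc hcδ hδ νN hfm hfN hfB h𝓕 h𝓕₀ h𝓕top _ hfin hs μF μE
    (Φ := (fun (X : AdeleRing (𝓞 E) E) (s : AdeleRing (𝓞 F) F) => f (((quasiSplit F E c 3).toAdelic (weylLongU (c : E →+* E) (rfl : ((StdForm.antidiagonal 3).over E) = ((StdForm.antidiagonal 3).over E)))) * ((heisChart hc (X, traceZeroLine F E c hcδ hδ s) : ↥(adelicUnipotent F E c 3)) : (quasiSplit F E c 3).Adelic) * (((heisChart hc (Xu, traceZeroLine F E c hcδ hδ tu) : ↥(adelicUnipotent F E c 3)) : (quasiSplit F E c 3).Adelic) * ((t : borelAdelic F E c 3) : (quasiSplit F E c 3).Adelic) * k)))) (fun _ _ => rfl) hsumN hΦc hΦi hloc (fun _ => rfl)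
    hΦZc hΦZi hlocZ hnorm (Φk := (fun (X : AdeleRing (𝓞 E) E) (s : AdeleRing (𝓞 F) F) => f (((quasiSplit F E c 3).toAdelic (weylLongU (c : E →+* E) (rfl : ((StdForm.antidiagonal 3).over E) = ((StdForm.antidiagonal 3).over E)))) * ((heisChart hc (X, traceZeroLine F E c hcδ hδ s) : ↥(adelicUnipotent F E c 3)) : (quasiSplit F E c 3).Adelic) * k))) (((χ (diagUnit (t : borelAdelic F E c 3).2 2) : ℂˣ) : ℂ) * ((ideleNorm (diagUnit (t : borelAdelic F E c 3).2 2) : ℝ) : ℂ) ^ z)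
    (((diagUnit (t : borelAdelic F E c 3).2 0)⁻¹ * diagUnit (t : borelAdelic F E c 3).2 1 : (AdeleRing (𝓞 E) E)ˣ)) Λ₂ (-Xu) (fun X => -(tu + (traceZeroLine F E c hcδ hδ).symm (coordY hc (heisChart hc (X, (0 : traceZeroAdele F E c)) * heisChart hc (Xu, (0 : traceZeroAdele F E c))))))
    (bigCell_heisenberg_dilation_three hc hcδ hδ χ z hf t Λ₂ hΛ₂ Xu tu k) (fun _ => rfl) hsF hsA hsE hB hCE hdF hdE hm hL le_rfl hΛle hθ hσE

/-- **R6d₃ ASSEMBLED — THE UNIFORM BOUND IN THE CUSP OF `U(J₃)` (the shape R6e consumes at `N = 3`):** under the Iwasawa decomposition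
`G(𝔸) = N(𝔸)·T(𝔸)·K` with `H ≤ T` on `K` (`hIw`, `hK`), the per-`g` Poisson ∕ Godement ∕ normalisation hypotheses of part (a)₃ (two layers, (D2-c) FILE A∕B by name),
the two Fourier-side decay binders on `K`, the section law of exponent `z` with `χ` unitary, `θ + 1 ≤ Re z + β_F` and `2 ≤ Re z + β_E`:
`∀ g, T < H(g) → ‖E(f)(g) − E(f)_B(g)‖ ≤ μ_F(D_F)⁻¹·B + μ_E(D_E)⁻¹·C_E`. [cite: Garrett2018, §2.9] [cite: MoeglinWaldspurger1995, I.2.12] -/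
theorem forall_norm_sub_borelConstantTerm_le_three (hc : c * c = 1) (hcδ : c δ = -δ) (hδ : δ ≠ 0)
    [MeasurableSpace (quasiSplit F E c 3).Adelic] [BorelSpace (quasiSplit F E c 3).Adelic]
    (νN : Measure ↥(adelicUnipotent F E c 3)) [νN.IsMulLeftInvariant] [νN.IsInvInvariant]
    (χ : HeckeCharacter E) (hχ : χ.IsUnitary) (z : ℂ) {f : (quasiSplit F E c 3).Adelic → ℂ} (hfm : Measurable f)
    (hfN : ∀ (n : ↥(adelicUnipotent F E c 3)) (y : (quasiSplit F E c 3).Adelic), f ((n : (quasiSplit F E c 3).Adelic) * y) = f y)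
    (hfB : ∀ b ∈ borelU (c : E →+* E) ((StdForm.antidiagonal 3).over E), ∀ x : (quasiSplit F E c 3).Adelic, f ((quasiSplit F E c 3).toAdelic b * x) = f x)
    (hf : ∀ (b g : (quasiSplit F E c 3).Adelic) (hb : b ∈ borelAdelic F E c 3),
      f (b * g) = ((χ (diagUnit hb 0) : ℂˣ) : ℂ) * ((ideleNorm (diagUnit hb 0) : ℝ) : ℂ) ^ z * f g)
    {𝓕 : Set ↥(adelicUnipotent F E c 3)} (h𝓕 : IsFundamentalDomain ↥(rationalUnipotent F E c 3) 𝓕 νN) (h𝓕₀ : νN 𝓕 ≠ 0) (h𝓕top : νN 𝓕 ≠ ⊤)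
    [MeasurableSpace (AdeleRing (𝓞 F) F)] [BorelSpace (AdeleRing (𝓞 F) F)] (μF : Measure (AdeleRing (𝓞 F) F)) [μF.IsAddHaarMeasure]
    [MeasurableSpace (AdeleRing (𝓞 E) E)] [BorelSpace (AdeleRing (𝓞 E) E)] (μE : Measure (AdeleRing (𝓞 E) E)) [μE.IsAddHaarMeasure]
    {B CE βF βE θ T : ℝ} (hB : 0 ≤ B) (hCE : 0 ≤ CE) (hθ : θ + 1 ≤ z.re + βF) (hσE : 2 ≤ z.re + βE)
    -- Iwasawa decomposition through a set `K` on which the height is at most `T`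
    {K : Set (quasiSplit F E c 3).Adelic} (hK : ∀ k ∈ K, (borelHeight k : ℝ) ≤ T)
    (hIw : ∀ g : (quasiSplit F E c 3).Adelic, ∃ (Xu : AdeleRing (𝓞 E) E) (tu : AdeleRing (𝓞 F) F) (t : ↥(torusInBorel F E c 3)), ∃ k ∈ K,
      g = (((heisChart hc (Xu, traceZeroLine F E c hcδ hδ tu) : ↥(adelicUnipotent F E c 3)) : (quasiSplit F E c 3).Adelic) * ((t : borelAdelic F E c 3) : (quasiSplit F E c 3).Adelic) * k))
    -- Godement ∕ summability ∕ Poisson (two layers) ∕ normalisation at every `g`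
    (hfin : ∀ g : (quasiSplit F E c 3).Adelic, ∫⁻ u in 𝓕, (∑' q : (quasiSplit F E c 3).quotientSubgroup ⧸ (borelAdelic F E c 3).subgroupOf (quasiSplit F E c 3).quotientSubgroup,
        ‖f ((((q.out : (quasiSplit F E c 3).quotientSubgroup) : (quasiSplit F E c 3).Adelic))⁻¹ * (u : (quasiSplit F E c 3).Adelic) * g)‖ₑ) ∂νN < ⊤)
    (hs : ∀ g : (quasiSplit F E c 3).Adelic, Summable fun q : Quotient (orbitRel ↥(borelU (c : E →+* E) ((StdForm.antidiagonal 3).over E)) ↥(unitaryGroupOfForm (c : E →+* E) ((StdForm.antidiagonal 3).over E))) =>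
      f ((quasiSplit F E c 3).toAdelic (Quotient.out q : ↥(unitaryGroupOfForm (c : E →+* E) ((StdForm.antidiagonal 3).over E))) * g))
    (hsumN : ∀ g : (quasiSplit F E c 3).Adelic, Summable fun p : E × F => ‖f (((quasiSplit F E c 3).toAdelic (weylLongU (c : E →+* E) (rfl : ((StdForm.antidiagonal 3).over E) = ((StdForm.antidiagonal 3).over E)))) * ((heisChart hc (algebraMap E (AdeleRing (𝓞 E) E) p.1, traceZeroLine F E c hcδ hδ (algebraMap F (AdeleRing (𝓞 F) F) p.2)) : ↥(adelicUnipotent F E c 3)) : (quasiSplit F E c 3).Adelic) * g)‖)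
    (hΦc : ∀ g : (quasiSplit F E c 3).Adelic, ∀ x₀ : E, Continuous fun s : AdeleRing (𝓞 F) F => f (((quasiSplit F E c 3).toAdelic (weylLongU (c : E →+* E) (rfl : ((StdForm.antidiagonal 3).over E) = ((StdForm.antidiagonal 3).over E)))) * ((heisChart hc (algebraMap E (AdeleRing (𝓞 E) E) x₀, traceZeroLine F E c hcδ hδ s) : ↥(adelicUnipotent F E c 3)) : (quasiSplit F E c 3).Adelic) * g))
    (hΦi : ∀ g : (quasiSplit F E c 3).Adelic, ∀ x₀ : E, Integrable (fun s : AdeleRing (𝓞 F) F => f (((quasiSplit F E c 3).toAdelic (weylLongU (c : E →+* E) (rfl : ((StdForm.antidiagonal 3).over E) = ((StdForm.antidiagonal 3).over E)))) * ((heisChart hc (algebraMap E (AdeleRing (𝓞 E) E) x₀, traceZeroLine F E c hcδ hδ s) : ↥(adelicUnipotent F E c 3)) : (quasiSplit F E c 3).Adelic) * g)) μF)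
    (hloc : ∀ g : (quasiSplit F E c 3).Adelic, ∀ x₀ : E, ∀ C₀ : Set (AdeleRing (𝓞 F) F), IsCompact C₀ → ∃ u : F → ℝ, Summable u ∧
      ∀ x ∈ C₀, ∀ ξ : F, ‖f (((quasiSplit F E c 3).toAdelic (weylLongU (c : E →+* E) (rfl : ((StdForm.antidiagonal 3).over E) = ((StdForm.antidiagonal 3).over E)))) * ((heisChart hc (algebraMap E (AdeleRing (𝓞 E) E) x₀, traceZeroLine F E c hcδ hδ (x + algebraMap F (AdeleRing (𝓞 F) F) ξ)) : ↥(adelicUnipotent F E c 3)) : (quasiSplit F E c 3).Adelic) * g)‖ ≤ u ξ)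
    (hΦZc : ∀ g : (quasiSplit F E c 3).Adelic, Continuous (fun X : AdeleRing (𝓞 E) E => ((μF (adeleFundamentalDomain F)).toReal⁻¹ : ℂ) * ∫ s, f (((quasiSplit F E c 3).toAdelic (weylLongU (c : E →+* E) (rfl : ((StdForm.antidiagonal 3).over E) = ((StdForm.antidiagonal 3).over E)))) * ((heisChart hc (X, traceZeroLine F E c hcδ hδ s) : ↥(adelicUnipotent F E c 3)) : (quasiSplit F E c 3).Adelic) * g) ∂μF))
    (hΦZi : ∀ g : (quasiSplit F E c 3).Adelic, Integrable (fun X : AdeleRing (𝓞 E) E => ((μF (adeleFundamentalDomain F)).toReal⁻¹ : ℂ) * ∫ s, f (((quasiSplit F E c 3).toAdelic (weylLongU (c : E →+* E) (rfl : ((StdForm.antidiagonal 3).over E) = ((StdForm.antidiagonal 3).over E)))) * ((heisChart hc (X, traceZeroLine F E c hcδ hδ s) : ↥(adelicUnipotent F E c 3)) : (quasiSplit F E c 3).Adelic) * g) ∂μF) μE)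
    (hlocZ : ∀ g : (quasiSplit F E c 3).Adelic, ∀ C₀ : Set (AdeleRing (𝓞 E) E), IsCompact C₀ → ∃ u : E → ℝ, Summable u ∧
      ∀ x ∈ C₀, ∀ ξ : E, ‖((μF (adeleFundamentalDomain F)).toReal⁻¹ : ℂ) * ∫ s, f (((quasiSplit F E c 3).toAdelic (weylLongU (c : E →+* E) (rfl : ((StdForm.antidiagonal 3).over E) = ((StdForm.antidiagonal 3).over E)))) * ((heisChart hc ((x + algebraMap E (AdeleRing (𝓞 E) E) ξ), traceZeroLine F E c hcδ hδ s) : ↥(adelicUnipotent F E c 3)) : (quasiSplit F E c 3).Adelic) * g) ∂μF‖ ≤ u ξ)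
    (hnorm : ∀ g : (quasiSplit F E c 3).Adelic, ((νN 𝓕).toReal⁻¹ : ℝ) • ∫ v : ↥(adelicUnipotent F E c 3), f (((quasiSplit F E c 3).toAdelic (weylLongU (c : E →+* E) (rfl : ((StdForm.antidiagonal 3).over E) = ((StdForm.antidiagonal 3).over E)))) * (v : (quasiSplit F E c 3).Adelic) * g) ∂νN =
      ((μE (adeleFundamentalDomain E)).toReal⁻¹ : ℂ) * ∫ X, ((μF (adeleFundamentalDomain F)).toReal⁻¹ : ℂ) * ∫ s, f (((quasiSplit F E c 3).toAdelic (weylLongU (c : E →+* E) (rfl : ((StdForm.antidiagonal 3).over E) = ((StdForm.antidiagonal 3).over E)))) * ((heisChart hc (X, traceZeroLine F E c hcδ hδ s) : ↥(adelicUnipotent F E c 3)) : (quasiSplit F E c 3).Adelic) * g) ∂μF ∂μE)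
    -- the two Fourier-side decay binders on `K`
    (hdecF : ∀ k ∈ K, ∀ (l₁ : (AdeleRing (𝓞 E) E)ˣ) (l₂ : (AdeleRing (𝓞 F) F)ˣ) (Y : AdeleRing (𝓞 E) E), ((IdeleClassGroup.ideleNorm F l₂ : ℝ≥0) : ℝ) ≤ 1 →
      ((IdeleClassGroup.ideleNorm E l₁ : ℝ≥0) : ℝ) = ((IdeleClassGroup.ideleNorm F l₂ : ℝ≥0) : ℝ) →
      (∀ x₀ : E, Summable fun η : F =>
        ‖∫ v, f (((quasiSplit F E c 3).toAdelic (weylLongU (c : E →+* E) (rfl : ((StdForm.antidiagonal 3).over E) = ((StdForm.antidiagonal 3).over E)))) * ((heisChart hc ((l₁ : AdeleRing (𝓞 E) E) * (algebraMap E (AdeleRing (𝓞 E) E) x₀ - Y), traceZeroLine F E c hcδ hδ v) : ↥(adelicUnipotent F E c 3)) : (quasiSplit F E c 3).Adelic) * k) * (adeleAddChar F (algebraMap F (AdeleRing (𝓞 F) F) η * ((l₂⁻¹ : (AdeleRing (𝓞 F) F)ˣ) : AdeleRing (𝓞 F) F) * v) : ℂ) ∂μF‖) ∧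
      (Summable fun x₀ : E => ∑' η : F, ({0}ᶜ : Set F).indicator (fun η =>
        ‖∫ v, f (((quasiSplit F E c 3).toAdelic (weylLongU (c : E →+* E) (rfl : ((StdForm.antidiagonal 3).over E) = ((StdForm.antidiagonal 3).over E)))) * ((heisChart hc ((l₁ : AdeleRing (𝓞 E) E) * (algebraMap E (AdeleRing (𝓞 E) E) x₀ - Y), traceZeroLine F E c hcδ hδ v) : ↥(adelicUnipotent F E c 3)) : (quasiSplit F E c 3).Adelic) * k) * (adeleAddChar F (algebraMap F (AdeleRing (𝓞 F) F) η * ((l₂⁻¹ : (AdeleRing (𝓞 F) F)ˣ) : AdeleRing (𝓞 F) F) * v) : ℂ) ∂μF‖) η) ∧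
      ∑' x₀ : E, ∑' η : F, ({0}ᶜ : Set F).indicator (fun η =>
          ‖∫ v, f (((quasiSplit F E c 3).toAdelic (weylLongU (c : E →+* E) (rfl : ((StdForm.antidiagonal 3).over E) = ((StdForm.antidiagonal 3).over E)))) * ((heisChart hc ((l₁ : AdeleRing (𝓞 E) E) * (algebraMap E (AdeleRing (𝓞 E) E) x₀ - Y), traceZeroLine F E c hcδ hδ v) : ↥(adelicUnipotent F E c 3)) : (quasiSplit F E c 3).Adelic) * k) * (adeleAddChar F (algebraMap F (AdeleRing (𝓞 F) F) η * ((l₂⁻¹ : (AdeleRing (𝓞 F) F)ˣ) : AdeleRing (𝓞 F) F) * v) : ℂ) ∂μF‖) η ≤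
        B * (((IdeleClassGroup.ideleNorm F l₂ : ℝ≥0) : ℝ)⁻¹) ^ θ * (((IdeleClassGroup.ideleNorm F l₂ : ℝ≥0) : ℝ)⁻¹) ^ (-βF))
    (hdecE : ∀ k ∈ K, ∀ l₁ : (AdeleRing (𝓞 E) E)ˣ, ((IdeleClassGroup.ideleNorm E l₁ : ℝ≥0) : ℝ) ≤ 1 →
      (Summable fun ξ : E =>
        ‖∫ V, (((μF (adeleFundamentalDomain F)).toReal⁻¹ : ℂ) * ∫ s, f (((quasiSplit F E c 3).toAdelic (weylLongU (c : E →+* E) (rfl : ((StdForm.antidiagonal 3).over E) = ((StdForm.antidiagonal 3).over E)))) * ((heisChart hc (V, traceZeroLine F E c hcδ hδ s) : ↥(adelicUnipotent F E c 3)) : (quasiSplit F E c 3).Adelic) * k) ∂μF) * (adeleAddChar E (algebraMap E (AdeleRing (𝓞 E) E) ξ * ((l₁⁻¹ : (AdeleRing (𝓞 E) E)ˣ) : AdeleRing (𝓞 E) E) * V) : ℂ) ∂μE‖) ∧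
      ∑' ξ : E, ({0}ᶜ : Set E).indicator (fun ξ =>
          ‖∫ V, (((μF (adeleFundamentalDomain F)).toReal⁻¹ : ℂ) * ∫ s, f (((quasiSplit F E c 3).toAdelic (weylLongU (c : E →+* E) (rfl : ((StdForm.antidiagonal 3).over E) = ((StdForm.antidiagonal 3).over E)))) * ((heisChart hc (V, traceZeroLine F E c hcδ hδ s) : ↥(adelicUnipotent F E c 3)) : (quasiSplit F E c 3).Adelic) * k) ∂μF) * (adeleAddChar E (algebraMap E (AdeleRing (𝓞 E) E) ξ * ((l₁⁻¹ : (AdeleRing (𝓞 E) E)ˣ) : AdeleRing (𝓞 E) E) * V) : ℂ) ∂μE‖) ξ ≤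
        CE * (((IdeleClassGroup.ideleNorm E l₁ : ℝ≥0) : ℝ)⁻¹) ^ (-βE))
    :
    ∀ g : (quasiSplit F E c 3).Adelic, T < (borelHeight g : ℝ) →
      ‖eisensteinSeriesU f g - borelConstantTerm νN 𝓕 (eisensteinSeriesU f) g‖ ≤
        (μF (adeleFundamentalDomain F)).toReal⁻¹ * B + (μE (adeleFundamentalDomain E)).toReal⁻¹ * CE := by
  intro g hg
  obtain ⟨Xu, tu, t, k, hkK, rfl⟩ := hIw g
  exact norm_sub_borelConstantTerm_le_of_iwasawa_three hc hcδ hδ νN χ hχ z hfm hfN hfB hf h𝓕 h𝓕₀ h𝓕top μF μE hB hCE hθ hσE Xu tu t k (hK k hkK) hg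
    (hfin _) (hs _) (hsumN _) (hΦc _) (hΦi _) (hloc _) (hΦZc _) (hΦZi _) (hlocZ _) (hnorm _) (hdecF k hkK) (hdecE k hkK)

end Summit.HodgeConjecture.HodgeConjecture.Cruxes.H413.K2E1EisensteinMinusConstantTermCuspBoundU3

end
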